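import Summits.Ventures.HodgeRepro2.T5QuadraticCensusFinite
import Summits.Ventures.HodgeRepro2.T5CMCensusPackage

/-!
# T5CMCensusToy — the CM-field census instantiated: `ℚ(ζ₄) = ℚ(i)` is a CM field

Tier-5 kernel support (seat p8, blind lane; sub-step N3; README §10.5 (ii)(c) non-vacuity of the
`[IsCMField E]` hypothesis of T5-177 / T5-178 / T5-179 / T5-181).  Mathlib's
`IsCyclotomicExtension.Rat.isCMField` makes every non-trivial cyclotomic extension of `ℚ` a CM
field; on `L = ℚ(ζ₄)` this instantiates the CM-form census theorems:

* `isCMField_four` — `IsCMField L` for every fourth cyclotomic extension `L` of `ℚ`;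
* `exists_finite_census_cm_four`, `exists_census_cm_four`, `exists_census_local_cm_four` — the
  census theorems of T5-177 / T5-178 / T5-181 hold on `ℚ(i)` over its maximal real subfield
  (a concrete carrier for every `∀ E, [IsCMField E] → …` statement of this lane).

No `sorry`, no axiom beyond `propext`, `Classical.choice`, `Quot.sound`.
-/

namespace Summit.Ventures.HodgeRepro2.T5CMCensusToy

open NumberField IsDedekindDomain HeightOneSpectrum

variable (L : Type*) [Field L] [CharZero L] [IsCyclotomicExtension {2 ^ 2} ℚ L]

/-- `ℚ(ζ₄)` is a CM field (Mathlib's `IsCyclotomicExtension.Rat.isCMField`, `2 < 4`). -/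
theorem isCMField_four : IsCMField L :=
  IsCyclotomicExtension.Rat.isCMField L (S := {2 ^ 2}) ⟨2 ^ 2, Set.mem_singleton _, by norm_num⟩

/-- The census with a finite exceptional set (T5-181), on `ℚ(i)` over its maximal real subfield. -/
theorem exists_finite_census_cm_four :
    haveI : NumberField L := IsCyclotomicExtension.numberField {2 ^ 2} ℚ L
    haveI : IsCMField L := isCMField_four L
    ∃ (d : 𝓞 (maximalRealSubfield L)) (S : Set (HeightOneSpectrum (𝓞 (maximalRealSubfield L)))),
      S.Finite ∧ ∀ v ∉ S,
        ((∃ w : HeightOneSpectrum (𝓞 L), w.asIdeal.LiesOver v.asIdeal ∧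
            (∀ w' : HeightOneSpectrum (𝓞 L), w'.asIdeal.LiesOver v.asIdeal → w' = w) ∧
            v.asIdeal.ramificationIdx' w.asIdeal = 1 ∧ v.asIdeal.inertiaDeg' w.asIdeal = 2) ↔
          ¬ IsSquare (Ideal.Quotient.mk v.asIdeal d)) ∧
        ((∃ w : HeightOneSpectrum (𝓞 L),
            v.asIdeal.map (algebraMap (𝓞 (maximalRealSubfield L)) (𝓞 L)) = w.asIdeal) ↔
          ¬ IsSquare (Ideal.Quotient.mk v.asIdeal d)) ∧
        (IsSquare (Ideal.Quotient.mk v.asIdeal d) →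
          ∃ w₁ w₂ : HeightOneSpectrum (𝓞 L), w₁ ≠ w₂ ∧
            w₁.asIdeal.LiesOver v.asIdeal ∧ w₂.asIdeal.LiesOver v.asIdeal) := by
  haveI : NumberField L := IsCyclotomicExtension.numberField {2 ^ 2} ℚ L
  haveI : IsCMField L := isCMField_four L
  exact T5QuadraticCensusFinite.exists_finite_census_cm L

/-- The Legendre-symbol census (T5-177) on `ℚ(i)` over its maximal real subfield. -/
theorem exists_census_cm_four :
    haveI : NumberField L := IsCyclotomicExtension.numberField {2 ^ 2} ℚ L
    haveI : IsCMField L := isCMField_four L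
    ∃ d : 𝓞 (maximalRealSubfield L), ∀ v : HeightOneSpectrum (𝓞 (maximalRealSubfield L)),
      4 * d ∉ v.asIdeal →
        ((∃ w : HeightOneSpectrum (𝓞 L),
            v.asIdeal.map (algebraMap (𝓞 (maximalRealSubfield L)) (𝓞 L)) = w.asIdeal) ↔
          ¬ IsSquare (Ideal.Quotient.mk v.asIdeal d)) := by
  haveI : NumberField L := IsCyclotomicExtension.numberField {2 ^ 2} ℚ L
  haveI : IsCMField L := isCMField_four L
  exact T5QuadraticGenerator.exists_census_cm L

/-- The local census (T5-178) on `ℚ(i)` over its maximal real subfield. -/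
theorem exists_census_local_cm_four :
    haveI : NumberField L := IsCyclotomicExtension.numberField {2 ^ 2} ℚ L
    haveI : IsCMField L := isCMField_four L
    ∃ d : 𝓞 (maximalRealSubfield L), ∀ v : HeightOneSpectrum (𝓞 (maximalRealSubfield L)),
      4 * d ∉ v.asIdeal →
        ((∃ w : HeightOneSpectrum (𝓞 L), w.asIdeal.LiesOver v.asIdeal ∧
            (∀ w' : HeightOneSpectrum (𝓞 L), w'.asIdeal.LiesOver v.asIdeal → w' = w) ∧
            v.asIdeal.ramificationIdx' w.asIdeal = 1 ∧ v.asIdeal.inertiaDeg' w.asIdeal = 2) ↔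
          ¬ IsSquare (Ideal.Quotient.mk v.asIdeal d)) := by
  haveI : NumberField L := IsCyclotomicExtension.numberField {2 ^ 2} ℚ L
  haveI : IsCMField L := isCMField_four L
  exact T5QuadraticInertBridge.exists_census_local_cm L

end Summit.Ventures.HodgeRepro2.T5CMCensusToy
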